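import Literature.Geometry.ComplexHyperbolic.UnitBallLieAlgebraCubicInvariantJets   -- ★ (b3) FILE A p846605 (F0P2-p01 (g14)): `lieLaplacian_tripleCommutator_invP₃`, `contDiff_invP₃`, `contDiff_negCubeSum`, `sum_neg_iteratedFDeriv_two_negCubeSum`, `sum_sum_sum_iteratedFDeriv_three_negCubeSum_smul`; brings ★ (b2) FILE 2, ★ (b3-pre)
import Literature.Geometry.ComplexHyperbolic.UnitBallLieAlgebraHCClosure           -- ★ (d2) FILE 1 p846595 (owner F0P3a-p05 (g15)): `contDiff_lieLaplacian`, `hasCompactSupport_lieLaplacian`, `integrable_apply_conj_torusH`, `liePhi_const_smul`, `isOpen_setOf_rootProduct_ne_zero`, `contDiffOn_liePhi`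
import HarnessLib

/-!
# Harish-Chandra's equation for the CUBIC invariant operator on `𝔲(2,1)`: `φ_{∂(D³P₃)f} = 6·Σ_k ∂_k³ φ_f` at regular points
# (ROAD «A6-IV» brick (b3) «THE CUBIC GENERATOR», FILE B — the head; Harish-Chandra 1957 Thm. 1, Warner II §8.4.1∕§8.4.3)

Topic `Geometry/ComplexHyperbolic`; namespace `Literature.Geometry.ComplexHyperbolic.BallModel`.  THEOREMS ONLY (no `def`, no instance, no notation, no axiom, no named fact,
no `sorry`).  Cell `pub/hodgecm-mathlib`, ENGINE T1 (crux H413 = `stmt-HodgeConjecture-24833`); ROAD A, design of record `DESIGN-A6-InHouse-v2-ArchitectureIV` 93542b84 (LEAD T11-4),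
SPEC fb65bd65 brick (b3); owner F0P3a-p05 (g15) R-15.7 (1)∕R-15.8 («=» head + constant + two-file cut); statement-first F0P2-p01 (g14) `…HCCubic.statementfirst.F0P2p01g14.lean`
e4ba8f235e417630 (head byte-identical below) and his FILE B handoff `HANDOFF-b3-FILEB.F0P2p01g14.md`; author F0P3-p01 (g17), 2026-09-01.

THE MATHEMATICS (`φ_h = liePhi μ h = π • Φ_h`, `L = lieLaplacian = ∂(ω)`, `P₃ = invP₃`, `p̄₃(θ) = P₃(torusH θ) = −(θ₀³+θ₁³+θ₂³)`, `U = {rootProduct ≠ 0}` the open regular set,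
`M χ = −Δ_θ χ = Σ_k (−1)•D²χ[e_k,e_k]` the flat operator of ★ (b2) on `𝔧 ≅ ℝ³` with `w ≡ −1`; `μ` finite on compacta and right-invariant, `f ∈ C_c^∞(M₃(ℂ); E)`).
* §1 the two words through `φ`: `P₃ •` preserves `C_c^∞` (with ★ HCClosure for `L`), and the FOUR-TERM linearity of `h ↦ φ_h(θ)` at a regular `θ` (integrability of each word on the compact
  carrier ★ `integrable_apply_conj_torusH`).
* §2 (E2) IN OPERATOR FORM AND ITERATED: ★ (b3-pre) `liePhi_lieLaplacian` says `φ_{Lh} = M φ_h` ON `U` for every `h ∈ C_c^∞`; since `U` is open and `M` is LOCAL (★ (b2)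
  `weightedSecondIterated_congr_of_eventuallyEq`), functions that agree on `U` have `M`-images that agree on `U`, whence `φ_{L²h} = M²φ_h`, `φ_{L³h} = M³φ_h` on `U`
  (`L` preserves `C_c^∞`, ★ HCClosure), and with ★ `liePhi_invP₃_smul` (`φ_{P₃h} = p̄₃·φ_h` everywhere) the four transported words
  `φ_{L³(P₃f)} = M³(p̄₃φ_f)`, `φ_{L²(P₃Lf)} = M²(p̄₃Mφ_f)`, `φ_{L(P₃L²f)} = M(p̄₃M²φ_f)`, `φ_{P₃L³f} = p̄₃M³φ_f` at `θ ∈ U`.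
* §3 THE HEAD **`liePhi μ (lieCubic f) θ = 6 • Σ_k D³(liePhi μ f)(θ)[e_k,e_k,e_k]`**: `8φ_{∂(D³P₃)f} = φ_{8∂(D³P₃)f} = φ_{L³(P₃f)} − 3φ_{L²(P₃Lf)} + 3φ_{L(P₃L²f)} − φ_{P₃L³f}` (★ FILE A
  `lieLaplacian_tripleCommutator_invP₃` as an identity of functions + §1) `= M³(p̄₃φ) − 3M²(p̄₃Mφ) + 3M(p̄₃M²φ) − p̄₃M³φ` (§2) `= 8·Σ_{abc}((−1)³D³p̄₃[e_a,e_b,e_c])•D³φ[e_a,e_b,e_c]`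
  (★ (b2) on `𝔧`: `Mp̄₃ = 6Σθ_k` is affine — ★ FILE A `sum_neg_iteratedFDeriv_two_negCubeSum`) `= 8·6·Σ_k∂_k³φ` (★ FILE A `sum_sum_sum_iteratedFDeriv_three_negCubeSum_smul`); cancel `8`.
  This is `φ_{∂(p)f} = ∂(p̄)φ_f` [Harish-Chandra 1957, Thm. 1] for the cubic generator `p = D³P₃` of `I(𝔤)` over the Casimir, in the cell's currency (constant `c₃′ = 6`).
HONEST LABEL: HC_CM is proved only modulo the printed citations until rung 0 closes; calculus over ★ (a1)(b1)(b2)(b3-pre), pays nothing by itself (consumer: (d2)).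

## References
* [HarishChandra1957DiffOps] Harish-Chandra, *Differential operators on a semisimple Lie algebra*, Amer. J. Math. 79 (1957) 87–120, Thm. 1 and §§2–3.
* [WarnerHASSLG2] G. Warner, *Harmonic Analysis on Semi-Simple Lie Groups II*, Grundlehren 189 (1972), §8.4.1, §8.4.3.
* [Helgason2000] S. Helgason, *Groups and Geometric Analysis* (2000), Ch. II §5.
-/

set_option autoImplicit false

noncomputable section

namespace Literature.Geometry.ComplexHyperbolic

namespace BallModel

open _root_.Complex _root_.Matrix _root_.MeasureTheory _root_.Set _root_.Filter _root_.Topology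
open Literature.Analysis.Calculus
open scoped Matrix.Norms.Operator ComplexConjugate ContDiff

variable {E : Type*} [NormedAddCommGroup E] [NormedSpace ℝ E]

/-! ## §1 The word `P₃ •` and the four-term linearity of `h ↦ φ_h(θ)` -/

section Words

/-- `h ↦ P₃ • h` preserves smoothness. [cite: WarnerHASSLG2, §8.4.1] -/
theorem contDiff_invP₃_smul {h : Matrix (Fin 3) (Fin 3) ℂ → E} (hh : ContDiff ℝ ∞ h) : ContDiff ℝ ∞ fun Y => invP₃ Y • h Y :=
  contDiff_invP₃.smul hh

omit [NormedSpace ℝ E] in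
/-- `h ↦ P₃ • h` preserves compact support. [cite: WarnerHASSLG2, §8.4.1] -/
theorem hasCompactSupport_invP₃_smul [NormedSpace ℝ E] {h : Matrix (Fin 3) (Fin 3) ℂ → E} (hhc : HasCompactSupport h) : HasCompactSupport fun Y => invP₃ Y • h Y :=
  hhc.smul_left

/-- `φ_{P₃ • h} = p̄₃ • φ_h` as FUNCTIONS on `𝔧` (★ (b3-pre) `liePhi_invP₃_smul`, `p̄₃(θ) = −(θ₀³+θ₁³+θ₂³)`). [cite: WarnerHASSLG2, §8.4.1] -/
theorem liePhi_invP₃_smul_eq_fun (μ : Measure U21) (h : Matrix (Fin 3) (Fin 3) ℂ → E) :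
    liePhi μ (fun Y => invP₃ Y • h Y) = fun θ : Fin 3 → ℝ => (-(θ 0 ^ 3 + θ 1 ^ 3 + θ 2 ^ 3)) • liePhi μ h θ :=
  funext fun θ => liePhi_invP₃_smul μ h θ

/-- **FOUR-TERM LINEARITY of `h ↦ φ_h(θ)`** off the noncompact walls, for continuous compactly supported words `a, b, c, d` (each integrand is integrable on the compact carrier ★ (a1′)).
[cite: WarnerHASSLG2, §8.4.1] -/
theorem liePhi_sub_smul_add_smul_sub (μ : Measure U21) [IsFiniteMeasureOnCompacts μ] {a b c d : Matrix (Fin 3) (Fin 3) ℂ → E} (ha : Continuous a) (hac : HasCompactSupport a)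
    (hb : Continuous b) (hbc : HasCompactSupport b) (hc : Continuous c) (hcc : HasCompactSupport c) (hd : Continuous d) (hdc : HasCompactSupport d) (r s : ℝ) (θ : Fin 3 → ℝ)
    (h02 : θ 0 ≠ θ 2) (h12 : θ 1 ≠ θ 2) :
    liePhi μ (fun X => a X - r • b X + s • c X - d X) θ = liePhi μ a θ - r • liePhi μ b θ + s • liePhi μ c θ - liePhi μ d θ := by
  have ia := integrable_apply_conj_torusH μ ha hac θ h02 h12
  have ib : Integrable (fun g : U21 => r • b (mat g * torusH θ * mat g⁻¹)) μ := (integrable_apply_conj_torusH μ hb hbc θ h02 h12).smul r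
  have ic : Integrable (fun g : U21 => s • c (mat g * torusH θ * mat g⁻¹)) μ := (integrable_apply_conj_torusH μ hc hcc θ h02 h12).smul s
  have id' := integrable_apply_conj_torusH μ hd hdc θ h02 h12
  have iab : Integrable (fun g : U21 => a (mat g * torusH θ * mat g⁻¹) - r • b (mat g * torusH θ * mat g⁻¹)) μ := ia.sub ib
  have iabc : Integrable (fun g : U21 => a (mat g * torusH θ * mat g⁻¹) - r • b (mat g * torusH θ * mat g⁻¹) + s • c (mat g * torusH θ * mat g⁻¹)) μ := iab.add ic
  simp only [liePhi_def, lieOrbital_def]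
  rw [integral_sub iabc id', integral_add iab ic, integral_sub ia ib, integral_smul, integral_smul, smul_sub, smul_add, smul_sub, smul_comm (rootProduct θ) r,
    smul_comm (rootProduct θ) s]

end Words

/-! ## §2 (E2) in operator form, iterated by locality on the open regular set -/

section Transport

variable [CompleteSpace E]

/-- **(E2) IN OPERATOR FORM**: at a regular `θ`, `φ_{∂(ω)h}(θ) = Σ_k (−1)•D²φ_h(θ)[e_k,e_k]` (★ (b3-pre) `liePhi_lieLaplacian`, the shape of ★ (b2)'s operators with `w ≡ −1`).
[cite: HarishChandra1957DiffOps, Thm. 1] [cite: WarnerHASSLG2, §8.4.1] -/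
theorem liePhi_lieLaplacian_eq_sum_neg_one_smul (μ : Measure U21) [IsFiniteMeasureOnCompacts μ] [μ.IsMulRightInvariant] {h : Matrix (Fin 3) (Fin 3) ℂ → E}
    (hh : ContDiff ℝ ∞ h) (hhc : HasCompactSupport h) (θ : Fin 3 → ℝ) (hθ : rootProduct θ ≠ 0) :
    liePhi μ (lieLaplacian h) θ = ∑ k : Fin 3, (-1 : ℝ) • iteratedFDeriv ℝ 2 (liePhi μ h) θ ![Pi.single k 1, Pi.single k 1] := by
  rw [liePhi_lieLaplacian μ hh hhc θ hθ]
  simp only [neg_one_smul, Finset.sum_neg_distrib]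

/-- **(E2) ITERATED BY LOCALITY** — for an operator `M` given everywhere by `M χ y = Σ_k (−1)•D²χ(y)[e_k,e_k]` and `h ∈ C_c^∞`: on the open regular set,
`φ_{Lh} = Mφ_h`, `φ_{L(Lh)} = M(Mφ_h)` and `φ_{L(L(Lh))} = M(M(Mφ_h))` (`L = lieLaplacian` preserves `C_c^∞` ★ HCClosure; `M` is local ★ (b2) `weightedSecondIterated_congr_of_eventuallyEq`).
[cite: HarishChandra1957DiffOps, Thm. 1] [cite: WarnerHASSLG2, §8.4.3] -/
theorem liePhi_lieLaplacian_iterate_eq (μ : Measure U21) [IsFiniteMeasureOnCompacts μ] [μ.IsMulRightInvariant] (M : ((Fin 3 → ℝ) → E) → (Fin 3 → ℝ) → E)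
    (hM : ∀ χ y, M χ y = ∑ k : Fin 3, (-1 : ℝ) • iteratedFDeriv ℝ 2 χ y ![Pi.single k 1, Pi.single k 1]) {h : Matrix (Fin 3) (Fin 3) ℂ → E} (hh : ContDiff ℝ ∞ h)
    (hhc : HasCompactSupport h) (θ : Fin 3 → ℝ) (hθ : rootProduct θ ≠ 0) :
    liePhi μ (lieLaplacian h) θ = M (liePhi μ h) θ ∧ liePhi μ (lieLaplacian (lieLaplacian h)) θ = M (M (liePhi μ h)) θ ∧
      liePhi μ (lieLaplacian (lieLaplacian (lieLaplacian h))) θ = M (M (M (liePhi μ h))) θ := by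
  have hM' : ∀ χ y, M χ y = ∑ k : Fin 3, (fun _ : Fin 3 => (-1 : ℝ)) k • iteratedFDeriv ℝ 2 χ y ![(fun k : Fin 3 => (Pi.single k 1 : Fin 3 → ℝ)) k, (fun k : Fin 3 => (Pi.single k 1 : Fin 3 → ℝ)) k] :=
    fun χ y => hM χ y
  have hU : IsOpen {y : Fin 3 → ℝ | rootProduct y ≠ 0} := isOpen_setOf_rootProduct_ne_zero
  -- (F1) on the regular set, for every `C_c^∞` word
  have F1 : ∀ {g : Matrix (Fin 3) (Fin 3) ℂ → E}, ContDiff ℝ ∞ g → HasCompactSupport g → ∀ {y : Fin 3 → ℝ}, rootProduct y ≠ 0 → liePhi μ (lieLaplacian g) y = M (liePhi μ g) y :=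
    fun hg hgc y hy => by rw [hM, liePhi_lieLaplacian_eq_sum_neg_one_smul μ hg hgc y hy]
  -- locality: agreement on the open regular set passes through `M`
  have hloc : ∀ {χ χ' : (Fin 3 → ℝ) → E}, (∀ y : Fin 3 → ℝ, rootProduct y ≠ 0 → χ y = χ' y) → ∀ {y : Fin 3 → ℝ}, rootProduct y ≠ 0 → M χ y = M χ' y :=
    fun hχ y hy => weightedSecondIterated_congr_of_eventuallyEq M hM' (Filter.eventually_of_mem (hU.mem_nhds hy) fun z hz => hχ z hz)
  have F2 : ∀ {g : Matrix (Fin 3) (Fin 3) ℂ → E}, ContDiff ℝ ∞ g → HasCompactSupport g → ∀ {y : Fin 3 → ℝ}, rootProduct y ≠ 0 →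
      liePhi μ (lieLaplacian (lieLaplacian g)) y = M (M (liePhi μ g)) y := fun hg hgc y hy => by
    rw [F1 (contDiff_lieLaplacian hg) (hasCompactSupport_lieLaplacian hgc) hy]
    exact hloc (fun z hz => F1 hg hgc hz) hy
  refine ⟨F1 hh hhc hθ, F2 hh hhc hθ, ?_⟩
  rw [F2 (contDiff_lieLaplacian hh) (hasCompactSupport_lieLaplacian hhc) hθ]
  exact hloc (fun z hz => hloc (fun w hw => F1 hh hhc hw) hz) hθ

/-- **THE FOUR TRANSPORTED WORDS** at a regular `θ` (`φ = liePhi μ f`, `p̄₃(y) = −(y₀³+y₁³+y₂³)`, `M` as above, `L = lieLaplacian`, `P₃ = invP₃`):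
`φ_{L(L(L(P₃•f)))}(θ) = M(M(M(p̄₃•φ)))(θ)`, `φ_{L(L(P₃•Lf))}(θ) = M(M(p̄₃•Mφ))(θ)`, `φ_{L(P₃•L(Lf))}(θ) = M(p̄₃•M(Mφ))(θ)`, `φ_{P₃•L(L(Lf))}(θ) = p̄₃(θ)•M(M(Mφ))(θ)`.
[cite: HarishChandra1957DiffOps, Thm. 1] [cite: WarnerHASSLG2, §8.4.3] -/
theorem liePhi_cubicWords_eq (μ : Measure U21) [IsFiniteMeasureOnCompacts μ] [μ.IsMulRightInvariant] (M : ((Fin 3 → ℝ) → E) → (Fin 3 → ℝ) → E)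
    (hM : ∀ χ y, M χ y = ∑ k : Fin 3, (-1 : ℝ) • iteratedFDeriv ℝ 2 χ y ![Pi.single k 1, Pi.single k 1]) {f : Matrix (Fin 3) (Fin 3) ℂ → E} (hf : ContDiff ℝ ∞ f)
    (hfc : HasCompactSupport f) (θ : Fin 3 → ℝ) (hθ : rootProduct θ ≠ 0) :
    liePhi μ (lieLaplacian (lieLaplacian (lieLaplacian (fun Y => invP₃ Y • f Y)))) θ =
        M (M (M (fun y : Fin 3 → ℝ => (-(y 0 ^ 3 + y 1 ^ 3 + y 2 ^ 3)) • liePhi μ f y))) θ ∧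
      liePhi μ (lieLaplacian (lieLaplacian (fun Y => invP₃ Y • lieLaplacian f Y))) θ =
        M (M (fun y : Fin 3 → ℝ => (-(y 0 ^ 3 + y 1 ^ 3 + y 2 ^ 3)) • M (liePhi μ f) y)) θ ∧
      liePhi μ (lieLaplacian (fun Y => invP₃ Y • lieLaplacian (lieLaplacian f) Y)) θ =
        M (fun y : Fin 3 → ℝ => (-(y 0 ^ 3 + y 1 ^ 3 + y 2 ^ 3)) • M (M (liePhi μ f)) y) θ ∧
      liePhi μ (fun Y => invP₃ Y • lieLaplacian (lieLaplacian (lieLaplacian f)) Y) θ =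
        (-(θ 0 ^ 3 + θ 1 ^ 3 + θ 2 ^ 3)) • M (M (M (liePhi μ f))) θ := by
  have hM' : ∀ χ y, M χ y = ∑ k : Fin 3, (fun _ : Fin 3 => (-1 : ℝ)) k • iteratedFDeriv ℝ 2 χ y ![(fun k : Fin 3 => (Pi.single k 1 : Fin 3 → ℝ)) k, (fun k : Fin 3 => (Pi.single k 1 : Fin 3 → ℝ)) k] :=
    fun χ y => hM χ y
  have hU : IsOpen {y : Fin 3 → ℝ | rootProduct y ≠ 0} := isOpen_setOf_rootProduct_ne_zero
  have hloc : ∀ {χ χ' : (Fin 3 → ℝ) → E}, (∀ y : Fin 3 → ℝ, rootProduct y ≠ 0 → χ y = χ' y) → ∀ {y : Fin 3 → ℝ}, rootProduct y ≠ 0 → M χ y = M χ' y :=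
    fun hχ y hy => weightedSecondIterated_congr_of_eventuallyEq M hM' (Filter.eventually_of_mem (hU.mem_nhds hy) fun z hz => hχ z hz)
  -- the `C_c^∞` words
  have hf₁ : ContDiff ℝ ∞ (lieLaplacian f) := contDiff_lieLaplacian hf
  have hf₁c : HasCompactSupport (lieLaplacian f) := hasCompactSupport_lieLaplacian hfc
  have hf₂ : ContDiff ℝ ∞ (lieLaplacian (lieLaplacian f)) := contDiff_lieLaplacian hf₁
  have hf₂c : HasCompactSupport (lieLaplacian (lieLaplacian f)) := hasCompactSupport_lieLaplacian hf₁c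
  refine ⟨?_, ?_, ?_, ?_⟩
  · -- `φ_{L³(P₃f)} = M³ φ_{P₃f}` and `φ_{P₃f} = p̄₃ φ` as functions
    rw [(liePhi_lieLaplacian_iterate_eq μ M hM (contDiff_invP₃_smul hf) (hasCompactSupport_invP₃_smul hfc) θ hθ).2.2, liePhi_invP₃_smul_eq_fun]
  · -- `φ_{L²(P₃Lf)} = M² φ_{P₃Lf} = M²(p̄₃ φ_{Lf})`, and `φ_{Lf} = Mφ` on the regular set passes through `M²` by locality
    rw [(liePhi_lieLaplacian_iterate_eq μ M hM (contDiff_invP₃_smul hf₁) (hasCompactSupport_invP₃_smul hf₁c) θ hθ).2.1, liePhi_invP₃_smul_eq_fun]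
    exact hloc (fun z hz => hloc (fun w hw => by rw [(liePhi_lieLaplacian_iterate_eq μ M hM hf hfc w hw).1]) hz) hθ
  · -- `φ_{L(P₃L²f)} = M φ_{P₃L²f} = M(p̄₃ φ_{L²f})`, and `φ_{L²f} = M²φ` on the regular set passes through `M`
    rw [(liePhi_lieLaplacian_iterate_eq μ M hM (contDiff_invP₃_smul hf₂) (hasCompactSupport_invP₃_smul hf₂c) θ hθ).1, liePhi_invP₃_smul_eq_fun]
    exact hloc (fun z hz => by rw [(liePhi_lieLaplacian_iterate_eq μ M hM hf hfc z hz).2.1]) hθ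
  · -- `φ_{P₃L³f}(θ) = p̄₃(θ) φ_{L³f}(θ) = p̄₃(θ) M³φ(θ)`
    rw [liePhi_invP₃_smul, (liePhi_lieLaplacian_iterate_eq μ M hM hf hfc θ hθ).2.2]

end Transport

/-! ## §3 The head: `φ_{∂(D³P₃)f} = 6·Σ_k ∂_k³ φ_f` -/

section Head

variable [CompleteSpace E]

/-- **(E3) HARISH-CHANDRA's EQUATION FOR THE CUBIC INVARIANT OPERATOR**: for `μ` finite on compacta and right-invariant, `f ∈ C^∞_c(M₃(ℂ); E)` and a regular `θ`,
`liePhi μ (lieCubic f) θ = 6 • Σ_k D³(liePhi μ f)(θ)[e_k, e_k, e_k]` — `φ_{∂(D³P₃)f} = ∂(q)φ_f` with `q = (1∕8)·ad(−Δ_θ)³(p̄₃·) = 6·Σ_k ∂_k³` (`p̄₃ = −Σθ_k³`): the 𝔤-side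
★ (b2) `8·∂(D³P₃) = ad(∂(ω))³(P₃·)` (since `∂(ω)P₃ = 18·P₁` is linear), transported word by word through `φ` by (E2) `φ_{∂(ω)h} = −Δ_θφ_h` and `φ_{P₃h} = p̄₃·φ_h`, and ★ (b2) again on 𝔧.
[cite: HarishChandra1957DiffOps, Thm. 1] [cite: WarnerHASSLG2, §8.4.1, §8.4.3] -/
theorem liePhi_lieCubic (μ : Measure U21) [IsFiniteMeasureOnCompacts μ] [μ.IsMulRightInvariant] {f : Matrix (Fin 3) (Fin 3) ℂ → E} (hf : ContDiff ℝ ∞ f)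
    (hfc : HasCompactSupport f) (θ : Fin 3 → ℝ) (hθ : rootProduct θ ≠ 0) :
    liePhi μ (lieCubic f) θ = (6 : ℝ) • ∑ k : Fin 3, iteratedFDeriv ℝ 3 (liePhi μ f) θ ![Pi.single k 1, Pi.single k 1, Pi.single k 1] := by
  obtain ⟨-, h02, h12⟩ := sub_ne_zero_of_rootProduct_ne_zero hθ
  have h02' : θ 0 ≠ θ 2 := sub_ne_zero.1 h02
  have h12' : θ 1 ≠ θ 2 := sub_ne_zero.1 h12
  have hU : IsOpen {y : Fin 3 → ℝ | rootProduct y ≠ 0} := isOpen_setOf_rootProduct_ne_zero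
  -- the flat operator `M = −Δ_θ` on `𝔧`, written as ★ (b2) wants it (`w ≡ −1`, `E_k = e_k`)
  obtain ⟨M, hMdef⟩ : ∃ M : ((Fin 3 → ℝ) → E) → (Fin 3 → ℝ) → E, M = fun χ y => ∑ k : Fin 3, (-1 : ℝ) • iteratedFDeriv ℝ 2 χ y ![Pi.single k 1, Pi.single k 1] := ⟨_, rfl⟩
  have hM : ∀ χ y, M χ y = ∑ k : Fin 3, (-1 : ℝ) • iteratedFDeriv ℝ 2 χ y ![Pi.single k 1, Pi.single k 1] := fun χ y => by rw [hMdef]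
  have hM' : ∀ χ y, M χ y = ∑ k : Fin 3, (fun _ : Fin 3 => (-1 : ℝ)) k • iteratedFDeriv ℝ 2 χ y ![(fun k : Fin 3 => (Pi.single k 1 : Fin 3 → ℝ)) k, (fun k : Fin 3 => (Pi.single k 1 : Fin 3 → ℝ)) k] :=
    fun χ y => hM χ y
  -- the `C_c^∞` words on `𝔤`
  have hf₁ : ContDiff ℝ ∞ (lieLaplacian f) := contDiff_lieLaplacian hf
  have hf₁c : HasCompactSupport (lieLaplacian f) := hasCompactSupport_lieLaplacian hfc
  have hf₂ : ContDiff ℝ ∞ (lieLaplacian (lieLaplacian f)) := contDiff_lieLaplacian hf₁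
  have hf₂c : HasCompactSupport (lieLaplacian (lieLaplacian f)) := hasCompactSupport_lieLaplacian hf₁c
  have hf₃ : ContDiff ℝ ∞ (lieLaplacian (lieLaplacian (lieLaplacian f))) := contDiff_lieLaplacian hf₂
  have hf₃c : HasCompactSupport (lieLaplacian (lieLaplacian (lieLaplacian f))) := hasCompactSupport_lieLaplacian hf₂c
  have hW₁ : ContDiff ℝ ∞ (lieLaplacian (lieLaplacian (lieLaplacian (fun Y => invP₃ Y • f Y)))) :=
    contDiff_lieLaplacian (contDiff_lieLaplacian (contDiff_lieLaplacian (contDiff_invP₃_smul hf)))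
  have hW₁c : HasCompactSupport (lieLaplacian (lieLaplacian (lieLaplacian (fun Y => invP₃ Y • f Y)))) :=
    hasCompactSupport_lieLaplacian (hasCompactSupport_lieLaplacian (hasCompactSupport_lieLaplacian (hasCompactSupport_invP₃_smul hfc)))
  have hW₂ : ContDiff ℝ ∞ (lieLaplacian (lieLaplacian (fun Y => invP₃ Y • lieLaplacian f Y))) := contDiff_lieLaplacian (contDiff_lieLaplacian (contDiff_invP₃_smul hf₁))
  have hW₂c : HasCompactSupport (lieLaplacian (lieLaplacian (fun Y => invP₃ Y • lieLaplacian f Y))) :=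
    hasCompactSupport_lieLaplacian (hasCompactSupport_lieLaplacian (hasCompactSupport_invP₃_smul hf₁c))
  have hW₃ : ContDiff ℝ ∞ (lieLaplacian (fun Y => invP₃ Y • lieLaplacian (lieLaplacian f) Y)) := contDiff_lieLaplacian (contDiff_invP₃_smul hf₂)
  have hW₃c : HasCompactSupport (lieLaplacian (fun Y => invP₃ Y • lieLaplacian (lieLaplacian f) Y)) := hasCompactSupport_lieLaplacian (hasCompactSupport_invP₃_smul hf₂c)
  have hW₄ : ContDiff ℝ ∞ (fun Y => invP₃ Y • lieLaplacian (lieLaplacian (lieLaplacian f)) Y) := contDiff_invP₃_smul hf₃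
  have hW₄c : HasCompactSupport (fun Y => invP₃ Y • lieLaplacian (lieLaplacian (lieLaplacian f)) Y) := hasCompactSupport_invP₃_smul hf₃c
  -- 𝔤 side: `8 • ∂(D³P₃)f = L³(P₃f) − 3L²(P₃Lf) + 3L(P₃L²f) − P₃L³f` as functions (★ FILE A)
  have hG : ((8 : ℝ) • lieCubic f : Matrix (Fin 3) (Fin 3) ℂ → E) = fun X =>
      lieLaplacian (lieLaplacian (lieLaplacian (fun Y => invP₃ Y • f Y))) X - (3 : ℝ) • lieLaplacian (lieLaplacian (fun Y => invP₃ Y • lieLaplacian f Y)) X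
        + (3 : ℝ) • lieLaplacian (fun Y => invP₃ Y • lieLaplacian (lieLaplacian f) Y) X - invP₃ X • lieLaplacian (lieLaplacian (lieLaplacian f)) X := by
    funext X
    rw [Pi.smul_apply]
    exact (lieLaplacian_tripleCommutator_invP₃ hf X).symm
  -- transport through `φ`: linearity + the four words
  have hwords := liePhi_cubicWords_eq μ M hM hf hfc θ hθ
  have h8 : (8 : ℝ) • liePhi μ (lieCubic f) θ =
      M (M (M (fun y : Fin 3 → ℝ => (-(y 0 ^ 3 + y 1 ^ 3 + y 2 ^ 3)) • liePhi μ f y))) θ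
        - (3 : ℝ) • M (M (fun y : Fin 3 → ℝ => (-(y 0 ^ 3 + y 1 ^ 3 + y 2 ^ 3)) • M (liePhi μ f) y)) θ
        + (3 : ℝ) • M (fun y : Fin 3 → ℝ => (-(y 0 ^ 3 + y 1 ^ 3 + y 2 ^ 3)) • M (M (liePhi μ f)) y) θ
        - (-(θ 0 ^ 3 + θ 1 ^ 3 + θ 2 ^ 3)) • M (M (M (liePhi μ f))) θ := by
    rw [← liePhi_const_smul μ (8 : ℝ) (lieCubic f) θ, hG,
      liePhi_sub_smul_add_smul_sub μ hW₁.continuous hW₁c hW₂.continuous hW₂c hW₃.continuous hW₃c hW₄.continuous hW₄c 3 3 θ h02' h12',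
      hwords.1, hwords.2.1, hwords.2.2.1, hwords.2.2.2]
  -- 𝔧 side: ★ (b2) with `M`, `p̄₃` (`Mp̄₃ = 6Σθ_k` affine ★ FILE A) and `φ` smooth on the open regular set
  have hLP : ∀ y : Fin 3 → ℝ, ∑ k : Fin 3, (fun _ : Fin 3 => (-1 : ℝ)) k • iteratedFDeriv ℝ 2 (fun θ : Fin 3 → ℝ => -(θ 0 ^ 3 + θ 1 ^ 3 + θ 2 ^ 3)) y
      ![(fun k : Fin 3 => (Pi.single k 1 : Fin 3 → ℝ)) k, (fun k : Fin 3 => (Pi.single k 1 : Fin 3 → ℝ)) k] =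
      ((6 : ℝ) • (ContinuousLinearMap.proj (R := ℝ) (φ := fun _ : Fin 3 => ℝ) 0 + ContinuousLinearMap.proj (R := ℝ) (φ := fun _ : Fin 3 => ℝ) 1 +
        ContinuousLinearMap.proj (R := ℝ) (φ := fun _ : Fin 3 => ℝ) 2)) y + 0 := fun y => by
    beta_reduce
    rw [sum_neg_iteratedFDeriv_two_negCubeSum, add_zero]
    simp only [FunLike.coe_smul, Pi.smul_apply, _root_.add_apply, ContinuousLinearMap.proj_apply, smul_eq_mul]
  have hJ := weightedSecond_tripleCommutator_smul_iteratedFDeriv (F := E) (E := fun k : Fin 3 => (Pi.single k 1 : Fin 3 → ℝ)) (w := fun _ : Fin 3 => (-1 : ℝ)) hU M hM'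
    contDiff_negCubeSum _ 0 hLP (contDiffOn_liePhi μ hf hfc) hθ
  beta_reduce at hJ
  have hC := sum_sum_sum_iteratedFDeriv_three_negCubeSum_smul θ (fun a b c => iteratedFDeriv ℝ 3 (liePhi μ f) θ ![Pi.single a 1, Pi.single b 1, Pi.single c 1])
  beta_reduce at hC
  rw [hC] at hJ
  -- assemble and cancel the `8`
  have h8' : (8 : ℝ) • liePhi μ (lieCubic f) θ = (8 : ℝ) • ((6 : ℝ) • ∑ k : Fin 3, iteratedFDeriv ℝ 3 (liePhi μ f) θ ![Pi.single k 1, Pi.single k 1, Pi.single k 1]) := by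
    rw [h8, ← hJ]
  exact smul_right_injective E (by norm_num : (8 : ℝ) ≠ 0) h8'

end Head

end BallModel

end Literature.Geometry.ComplexHyperbolic

end
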